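import Mathlib
import Literature.Analysis.FluidPDE.VectorCalculus
import Summits.NavierStokesRegularity.NavierStokesRegularity.Theorems.FilamentSkeletonRssSkeletonEquilibriumSlopeFormula
import Summits.NavierStokesRegularity.NavierStokesRegularity.Theorems.FilamentSkeletonRssSkeletonEquilibriumStrainOtherFilament
import Summits.NavierStokesRegularity.NavierStokesRegularity.Theorems.FilamentSkeletonRssSkeletonEquilibriumStrainSelfFilament

/-!
# The endgame of line `zero-accretion-selection`: tame near-vertical equilibria are subcritical

Composing stub `stub_tameVerticalSubcritical` (crux `SkeletonEquilibrium`, thesis `FilamentSkeletonRss`; lead a1).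
ASSEMBLY ONLY: the quantitative strain identity (landed `stub_slopeFormula`)
`w_j′(τ*) = ½ + Σ_k (Γγ_k/4π) ∫ I_k` plus the per-filament axial-strain bounds — `stub_strainOtherFilament`
(D1: far tail + in-ball tilt term, `|∫ I_k| ≤ 12C₀/(R²Γ) + 9θC₀R/(ρ³Γ)`) and `stub_strainSelfFilament` (D2: the
filament through the stagnation point, `|∫ I_j| ≤ (12C₀/R² + 9θC₀R/ρ′³ + 102(M+1)²ρ′/(log Γ)^(3/2) + 45(M+1)ε)/Γ`)
— give, with `G = Σ_k |γ_k|`, `C₂ = 3C₀G/π`, `C₁ = G(9C₀R/(4π min(ρ,ρ′)³) + 45(M+1)/(4π))` and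
`Γ ≥ Γ₄ = max 55 (exp(204(M+1)²ρ′G/π + 1))`: `w_j′(τ*) ≤ ½ + C₁(θ + ε) + C₂/R² + ⅛`.
`tameVertical_of_bounds` takes D1 and D2 as hypotheses; the registered stub `stub_tameVerticalSubcritical` feeds it the
landed `stub_strainOtherFilament` and `stub_strainSelfFilament`.
-/

noncomputable section

open MeasureTheory Filter Topology Literature.Analysis.FluidPDE
open scoped RealInnerProductSpace InnerProductSpace BigOperators

namespace Summit.NavierStokesRegularity.NavierStokesRegularity.Theorems.SkeletonEquilibrium.ZeroAccretionSelection
set_option linter.dupNamespace false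

/-- `iteratedDeriv 2 f = deriv (deriv f)`. [folklore] -/
theorem iteratedDeriv_two_eq (f : ℝ → EuclideanSpace ℝ (Fin 3)) : iteratedDeriv 2 f = deriv (deriv f) := by
  rw [iteratedDeriv_eq_iterate]; rfl

/-- **Assembly.** The endgame estimate from the slope formula and the two per-filament bounds (taken as
hypotheses `hD1`, `hD2`). [folklore] -/
theorem tameVertical_of_bounds
    (hD1 : ∀ (X : ℝ → EuclideanSpace ℝ (Fin 3)) (x₀ T₀ : EuclideanSpace ℝ (Fin 3)) (C₀ Γ R d θ : ℝ), ContDiff ℝ 2 X → (∀ σ, ‖deriv X σ‖ = 1) → 0 ≤ C₀ → 1 ≤ Γ → 1 ≤ R → 0 < d → 0 ≤ θ → θ ≤ 1 → ‖T₀‖ = 1 → ‖cross T₀ (EuclideanSpace.single (2 : Fin 3) (1 : ℝ))‖ ≤ θ → (∀ D : ℝ, Real.sqrt Γ ≤ D → volume {σ : ℝ | ‖X σ - x₀‖ ≤ D} ≤ ENNReal.ofReal (C₀ * D)) → (∀ σ, d * Real.sqrt Γ ≤ ‖x₀ - X σ‖) → (∀ σ, ‖X σ - x₀‖ ≤ R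 * Real.sqrt Γ → ‖cross (deriv X σ) (EuclideanSpace.single (2 : Fin 3) (1 : ℝ))‖ ≤ θ) → Integrable (fun σ : ℝ => (-3) * ((‖x₀ - X σ‖ ^ 2 + 1) ^ (5 / 2 : ℝ))⁻¹ * ⟪x₀ - X σ, T₀⟫ * ⟪cross (deriv X σ) (x₀ - X σ), T₀⟫) ∧ |∫ σ : ℝ, (-3) * ((‖x₀ - X σ‖ ^ 2 + 1) ^ (5 / 2 : ℝ))⁻¹ * ⟪x₀ - X σ, T₀⟫ * ⟪cross (deriv X σ) (x₀ - X σ), T₀⟫| ≤ 12 * C₀ / (R ^ 2 * Γ) + 9 * θ * C₀ * R / (d ^ 3 * Γ))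
    (hD2 : ∀ (X : ℝ → EuclideanSpace ℝ (Fin 3)) (τs C₀ Γ R ρ' θ M ε : ℝ), ContDiff ℝ 2 X → (∀ σ, ‖deriv X σ‖ = 1) → 0 ≤ C₀ → 55 ≤ Γ → 1 ≤ R → 0 < ρ' → ρ' ≤ 1 / 2 → 0 ≤ θ → θ ≤ 1 / 2 → 0 ≤ M → 0 ≤ ε → ε ≤ 1 → (∀ D : ℝ, Real.sqrt Γ ≤ D → volume {σ : ℝ | ‖X σ - X τs‖ ≤ D} ≤ ENNReal.ofReal (C₀ * D)) → (∀ σ, ‖X σ - X τs‖ ≤ R * Real.sqrt Γ → ‖cross (deriv X σ) (EuclideanSpace.single (2 : Fin 3) (1 : ℝ))‖ ≤ θ) → (∀ σ σ' : ℝ, ‖X σ - X τs‖ ≤ R * Real.sqrt Γ → ‖X σ' - X τs‖ ≤ R * Real.sqrt Γ → ‖deriv (deriv X) σ‖ * Real.sqrt (Γ * Real.log Γ / 2) ≤ M ∧ ‖deriv (deriv X) σ - deriv (deriv X) σ'‖ * Real.sqrt (Γ * Real.log Γ / 2) ≤ M * |σ - σ'| / Real.sqrt (Γ * Real.log Γ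 / 2) + ε) → (∀ σ σ' : ℝ, ‖X σ - X τs‖ ≤ R * Real.sqrt Γ → ‖X σ' - X τs‖ ≤ R * Real.sqrt Γ → ‖X σ - X σ'‖ < ρ' * Real.sqrt Γ → |σ - σ'| ≤ 2 * ‖X σ - X σ'‖) → Integrable (fun σ : ℝ => (-3) * ((‖X τs - X σ‖ ^ 2 + 1) ^ (5 / 2 : ℝ))⁻¹ * ⟪X τs - X σ, deriv X τs⟫ * ⟪cross (deriv X σ) (X τs - X σ), deriv X τs⟫) ∧ |∫ σ : ℝ, (-3) * ((‖X τs - X σ‖ ^ 2 + 1) ^ (5 / 2 : ℝ))⁻¹ * ⟪X τs - X σ, deriv X τs⟫ * ⟪cross (deriv X σ) (X τs - X σ), deriv X τs⟫| ≤ (12 * C₀ / R ^ 2 + 9 * θ * C₀ * R / ρ' ^ 3 + 102 * (M + 1) ^ 2 * ρ' / Real.log Γ ^ (3 / 2 : ℝ) + 45 * (M + 1) * ε) / Γ) :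
    ∀ (N : ℕ) (γ : Fin N → ℝ) (α ρ K C₀ : ℝ), 0 < ρ → 0 < C₀ → ∃ C₂ : ℝ, 0 ≤ C₂ ∧ ∀ (R ρ' M : ℝ), 1 ≤ R → 0 < ρ' → ρ' ≤ 1 / 2 → 0 ≤ M → ∃ C₁ : ℝ, 0 ≤ C₁ ∧ ∀ (θ ε : ℝ), 0 < θ → θ ≤ 1 / 2 → 0 < ε → ε ≤ 1 → ∃ Γ₄ : ℝ, ∀ Γ : ℝ, Γ₄ ≤ Γ → 2 ≤ Γ → ∀ (Ξ : Fin N → ℝ → EuclideanSpace ℝ (Fin 3)) (w : Fin N → ℝ → ℝ), (∀ j, ContDiff ℝ 2 (Ξ j) ∧ Function.Injective (Ξ j) ∧ Differentiable ℝ (w j) ∧ (∀ τ, ‖deriv (Ξ j) τ‖ = 1) ∧ (∀ τ, ‖iteratedDeriv 2 (Ξ j) τ‖ * Real.sqrt Γ ≤ K) ∧ Tendsto (fun τ => ‖Ξ j τ‖) atTop atTop ∧ Tendsto (fun τ => ‖Ξ j τ‖) atBot atTop) → (∀ j k, j ≠ k → ∀ τ σ, ρ * Real.sqrt Γ ≤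 ‖Ξ j τ - Ξ k σ‖) → (∀ j (x : EuclideanSpace ℝ (Fin 3)), Integrable (fun σ : ℝ => ((‖x - Ξ j σ‖ ^ 2 + 1) ^ (3 / 2 : ℝ))⁻¹ • cross (deriv (Ξ j) σ) (x - Ξ j σ))) → (∀ j τ, (∑ k : Fin N, (Γ * γ k / (4 * Real.pi)) • ∫ σ : ℝ, ((‖Ξ j τ - Ξ k σ‖ ^ 2 + 1) ^ (3 / 2 : ℝ))⁻¹ • cross (deriv (Ξ k) σ) (Ξ j τ - Ξ k σ)) + (1 / 2 : ℝ) • Ξ j τ - α • cross (EuclideanSpace.single (2 : Fin 3) (1 : ℝ)) (Ξ j τ) = w j τ • deriv (Ξ j) τ) → (∀ (k : Fin N) (x : EuclideanSpace ℝ (Fin 3)) (D : ℝ), Real.sqrt Γ ≤ D → volume {τ : ℝ | ‖Ξ k τ - x‖ ≤ D} ≤ ENNReal.ofReal (C₀ * D)) → ∀ (j : Fin N) (τs : ℝ), w j τs = 0 → (∀ (k : Fin N) (τ : ℝ), ‖Ξ k τ - Ξ j τs‖ ≤ R * Real.sqrt Γ → ‖cross (deriv (Ξ k) τ) (EuclideanSpace.single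 (2 : Fin 3) (1 : ℝ))‖ ≤ θ) → (∀ (k : Fin N) (τ τ' : ℝ), ‖Ξ k τ - Ξ j τs‖ ≤ R * Real.sqrt Γ → ‖Ξ k τ' - Ξ j τs‖ ≤ R * Real.sqrt Γ → ‖iteratedDeriv 2 (Ξ k) τ‖ * Real.sqrt (Γ * Real.log Γ / 2) ≤ M ∧ ‖iteratedDeriv 2 (Ξ k) τ - iteratedDeriv 2 (Ξ k) τ'‖ * Real.sqrt (Γ * Real.log Γ / 2) ≤ M * |τ - τ'| / Real.sqrt (Γ * Real.log Γ / 2) + ε) → (∀ (k : Fin N) (τ τ' : ℝ), ‖Ξ k τ - Ξ j τs‖ ≤ R * Real.sqrt Γ → ‖Ξ k τ' - Ξ j τs‖ ≤ R * Real.sqrt Γ → ‖Ξ k τ - Ξ k τ'‖ < ρ' * Real.sqrt Γ → |τ - τ'| ≤ 2 * ‖Ξ k τ - Ξ k τ'‖) → deriv (w j) τs ≤ 1 / 2 + C₁ * (θ + ε) + C₂ / R ^ 2 + 1 / 8 := by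
  intro N γ α ρ K C₀ hρ hC₀
  -- total circulation weight
  set G : ℝ := ∑ k : Fin N, |γ k| with hG
  have hGnn : 0 ≤ G := Finset.sum_nonneg fun k _ => abs_nonneg _
  have hγG : ∀ k, |γ k| ≤ G := fun k =>
    Finset.single_le_sum (f := fun k => |γ k|) (fun k _ => abs_nonneg _) (Finset.mem_univ k)
  refine ⟨3 * C₀ * G / Real.pi, by positivity, ?_⟩
  intro R ρ' M hR hρ' hρ'h hM
  set ρm : ℝ := min ρ ρ' with hρm
  have hρm0 : 0 < ρm := lt_min hρ hρ'
  refine ⟨G * (9 * C₀ * R / (4 * Real.pi * ρm ^ 3) + 45 * (M + 1) / (4 * Real.pi)), by positivity, ?_⟩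
  intro θ ε hθ hθh hε hε1
  set Q : ℝ := 204 * (M + 1) ^ 2 * ρ' * G / Real.pi with hQ
  have hQnn : 0 ≤ Q := by positivity
  refine ⟨max 55 (Real.exp (Q + 1)), ?_⟩
  intro Γ hΓ₄ hΓ2 Ξ w h1 h2 h3 h4 hL j τs hz hV hC hS
  have hΓ55 : (55 : ℝ) ≤ Γ := le_trans (le_max_left _ _) hΓ₄
  have hΓexp : Real.exp (Q + 1) ≤ Γ := le_trans (le_max_right _ _) hΓ₄
  have hΓ1 : (1 : ℝ) ≤ Γ := by linarith
  have hΓpos : 0 < Γ := by linarith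
  have hlog : Q + 1 ≤ Real.log Γ := by
    have := Real.log_le_log (Real.exp_pos _) hΓexp
    rwa [Real.log_exp] at this
  have hlog1 : 1 ≤ Real.log Γ := by linarith
  -- the slope formula
  obtain ⟨_, hslope⟩ := stub_slopeFormula N γ α Γ K C₀ hΓ1 hC₀ Ξ w h1 h3 h4 hL j τs
  -- per-filament data
  have hC2Ξ : ∀ k, ContDiff ℝ 2 (Ξ k) := fun k => (h1 k).1
  have hunit : ∀ k σ, ‖deriv (Ξ k) σ‖ = 1 := fun k => (h1 k).2.2.2.1
  have hθ0 : 0 ≤ θ := hθ.le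
  have hθ1 : θ ≤ 1 := by linarith
  have hT₀vert : ‖cross (deriv (Ξ j) τs) (EuclideanSpace.single (2 : Fin 3) (1 : ℝ))‖ ≤ θ :=
    hV j τs (by simp; positivity)
  -- the per-filament bounds
  have hbound : ∀ k : Fin N,
      |∫ σ : ℝ, (-3) * ((‖Ξ j τs - Ξ k σ‖ ^ 2 + 1) ^ (5 / 2 : ℝ))⁻¹ * ⟪Ξ j τs - Ξ k σ, deriv (Ξ j) τs⟫ *
          ⟪cross (deriv (Ξ k) σ) (Ξ j τs - Ξ k σ), deriv (Ξ j) τs⟫| ≤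
        12 * C₀ / (R ^ 2 * Γ) + 9 * θ * C₀ * R / (ρm ^ 3 * Γ) +
          (if k = j then (102 * (M + 1) ^ 2 * ρ' / Real.log Γ ^ (3 / 2 : ℝ) + 45 * (M + 1) * ε) / Γ else 0) := by
    intro k
    by_cases hkj : k = j
    · subst hkj
      -- D2 for the filament through the stagnation point
      have hCk : ∀ σ σ' : ℝ, ‖Ξ k σ - Ξ k τs‖ ≤ R * Real.sqrt Γ → ‖Ξ k σ' - Ξ k τs‖ ≤ R * Real.sqrt Γ →
          ‖deriv (deriv (Ξ k)) σ‖ * Real.sqrt (Γ * Real.log Γ / 2) ≤ M ∧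
          ‖deriv (deriv (Ξ k)) σ - deriv (deriv (Ξ k)) σ'‖ * Real.sqrt (Γ * Real.log Γ / 2) ≤
            M * |σ - σ'| / Real.sqrt (Γ * Real.log Γ / 2) + ε := by
        intro σ σ' hσ hσ'
        have := hC k σ σ' hσ hσ'
        rwa [iteratedDeriv_two_eq] at this
      have hD := (hD2 (Ξ k) τs C₀ Γ R ρ' θ M ε (hC2Ξ k) (hunit k) hC₀.le hΓ55 hR hρ' hρ'h hθ0 hθh hM hε.le hε1
        (fun D hD => hL k (Ξ k τs) D hD) (fun σ hσ => hV k σ hσ) hCk (fun σ σ' hσ hσ' => hS k σ σ' hσ hσ')).2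
      rw [if_pos rfl]
      refine hD.trans ?_
      have ea : (12 * C₀ / R ^ 2 + 9 * θ * C₀ * R / ρ' ^ 3 + 102 * (M + 1) ^ 2 * ρ' / Real.log Γ ^ (3 / 2 : ℝ) +
            45 * (M + 1) * ε) / Γ =
          12 * C₀ / (R ^ 2 * Γ) + 9 * θ * C₀ * R / ρ' ^ 3 / Γ +
            (102 * (M + 1) ^ 2 * ρ' / Real.log Γ ^ (3 / 2 : ℝ) + 45 * (M + 1) * ε) / Γ := by
        rw [add_assoc (12 * C₀ / R ^ 2 + 9 * θ * C₀ * R / ρ' ^ 3), add_div, add_div, div_div]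
      rw [ea]
      have e1 : 9 * θ * C₀ * R / ρ' ^ 3 / Γ ≤ 9 * θ * C₀ * R / (ρm ^ 3 * Γ) := by
        rw [div_div]
        apply div_le_div_of_nonneg_left (by positivity) (by positivity)
        exact mul_le_mul_of_nonneg_right (pow_le_pow_left₀ hρm0.le (min_le_right _ _) 3) hΓpos.le
      linarith
    · -- D1 for another filament, separation d = ρ
      have hsep : ∀ σ, ρ * Real.sqrt Γ ≤ ‖Ξ j τs - Ξ k σ‖ := fun σ => h2 j k (Ne.symm hkj) τs σ
      have hD := (hD1 (Ξ k) (Ξ j τs) (deriv (Ξ j) τs) C₀ Γ R ρ θ (hC2Ξ k) (hunit k) hC₀.le hΓ1 hR hρ hθ0 hθ1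
        (hunit j τs) hT₀vert (fun D hD => hL k (Ξ j τs) D hD) hsep (fun σ hσ => hV k σ hσ)).2
      rw [if_neg hkj, add_zero]
      refine hD.trans ?_
      have e1 : 9 * θ * C₀ * R / (ρ ^ 3 * Γ) ≤ 9 * θ * C₀ * R / (ρm ^ 3 * Γ) := by
        apply div_le_div_of_nonneg_left (by positivity) (by positivity)
        exact mul_le_mul_of_nonneg_right (pow_le_pow_left₀ hρm0.le (min_le_left _ _) 3) hΓpos.le
      linarith
  -- sum the bounds
  rw [hslope]
  have hterm : ∀ k : Fin N,
      (Γ * γ k / (4 * Real.pi)) * ∫ σ : ℝ, (-3) * ((‖Ξ j τs - Ξ k σ‖ ^ 2 + 1) ^ (5 / 2 : ℝ))⁻¹ *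
          ⟪Ξ j τs - Ξ k σ, deriv (Ξ j) τs⟫ * ⟪cross (deriv (Ξ k) σ) (Ξ j τs - Ξ k σ), deriv (Ξ j) τs⟫ ≤
        |γ k| / (4 * Real.pi) * (12 * C₀ / R ^ 2 + 9 * θ * C₀ * R / ρm ^ 3) +
          (if k = j then |γ k| / (4 * Real.pi) * (102 * (M + 1) ^ 2 * ρ' / Real.log Γ ^ (3 / 2 : ℝ) + 45 * (M + 1) * ε)
            else 0) := by
    intro k
    have hb := hbound k
    set J := ∫ σ : ℝ, (-3) * ((‖Ξ j τs - Ξ k σ‖ ^ 2 + 1) ^ (5 / 2 : ℝ))⁻¹ *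
          ⟪Ξ j τs - Ξ k σ, deriv (Ξ j) τs⟫ * ⟪cross (deriv (Ξ k) σ) (Ξ j τs - Ξ k σ), deriv (Ξ j) τs⟫ with hJ
    have hc : |Γ * γ k / (4 * Real.pi)| = Γ * |γ k| / (4 * Real.pi) := by
      rw [abs_div, abs_mul, abs_of_pos hΓpos, abs_of_pos (by positivity : (0:ℝ) < 4 * Real.pi)]
    calc (Γ * γ k / (4 * Real.pi)) * J ≤ |(Γ * γ k / (4 * Real.pi)) * J| := le_abs_self _
      _ = Γ * |γ k| / (4 * Real.pi) * |J| := by rw [abs_mul, hc]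
      _ ≤ Γ * |γ k| / (4 * Real.pi) * (12 * C₀ / (R ^ 2 * Γ) + 9 * θ * C₀ * R / (ρm ^ 3 * Γ) +
            (if k = j then (102 * (M + 1) ^ 2 * ρ' / Real.log Γ ^ (3 / 2 : ℝ) + 45 * (M + 1) * ε) / Γ else 0)) := by
          gcongr
      _ = |γ k| / (4 * Real.pi) * (12 * C₀ / R ^ 2 + 9 * θ * C₀ * R / ρm ^ 3) +
          (if k = j then |γ k| / (4 * Real.pi) * (102 * (M + 1) ^ 2 * ρ' / Real.log Γ ^ (3 / 2 : ℝ) + 45 * (M + 1) * ε)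
            else 0) := by
          split_ifs <;> first | (field_simp; ring) | field_simp
  have hsum := Finset.sum_le_sum fun k (_ : k ∈ Finset.univ) => hterm k
  rw [Finset.sum_add_distrib, Finset.sum_ite_eq' Finset.univ j, if_pos (Finset.mem_univ j),
    ← Finset.sum_mul] at hsum
  have hsum' : ∑ k : Fin N, |γ k| / (4 * Real.pi) = G / (4 * Real.pi) := by
    rw [hG, Finset.sum_div]
  rw [hsum', mul_add, mul_add] at hsum
  -- the four pieces
  have hlog32 : Real.log Γ ≤ Real.log Γ ^ (3 / 2 : ℝ) := by
    have := Real.self_le_rpow_of_one_le hlog1 (by norm_num : (1:ℝ) ≤ 3 / 2)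
    simpa using this
  have hQle : Q ≤ Real.log Γ ^ (3 / 2 : ℝ) := by linarith
  have hlogpos : 0 < Real.log Γ ^ (3 / 2 : ℝ) := by positivity
  have hA : G / (4 * Real.pi) * (12 * C₀ / R ^ 2) = 3 * C₀ * G / Real.pi / R ^ 2 := by
    field_simp; ring
  have hB : G / (4 * Real.pi) * (9 * θ * C₀ * R / ρm ^ 3) ≤
      G * (9 * C₀ * R / (4 * Real.pi * ρm ^ 3) + 45 * (M + 1) / (4 * Real.pi)) * θ := by
    have e : G / (4 * Real.pi) * (9 * θ * C₀ * R / ρm ^ 3) = G * (9 * C₀ * R / (4 * Real.pi * ρm ^ 3)) * θ := by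
      field_simp
    rw [e]
    gcongr
    linarith [show 0 ≤ 45 * (M + 1) / (4 * Real.pi) by positivity]
  have hx : |γ j| / (4 * Real.pi) * (102 * (M + 1) ^ 2 * ρ' / Real.log Γ ^ (3 / 2 : ℝ)) ≤ 1 / 8 := by
    have h1' : |γ j| / (4 * Real.pi) * (102 * (M + 1) ^ 2 * ρ' / Real.log Γ ^ (3 / 2 : ℝ)) ≤
        G / (4 * Real.pi) * (102 * (M + 1) ^ 2 * ρ' / Real.log Γ ^ (3 / 2 : ℝ)) := by
      gcongr
      exact hγG j
    have h2' : G / (4 * Real.pi) * (102 * (M + 1) ^ 2 * ρ' / Real.log Γ ^ (3 / 2 : ℝ)) =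
        (Q / 8) / Real.log Γ ^ (3 / 2 : ℝ) := by
      rw [hQ]; field_simp; ring
    rw [h2'] at h1'
    have h3' : (Q / 8) / Real.log Γ ^ (3 / 2 : ℝ) ≤ 1 / 8 := by
      rw [div_le_iff₀ hlogpos]; linarith
    linarith
  have hy : |γ j| / (4 * Real.pi) * (45 * (M + 1) * ε) ≤
      G * (9 * C₀ * R / (4 * Real.pi * ρm ^ 3) + 45 * (M + 1) / (4 * Real.pi)) * ε := by
    have e1 : |γ j| / (4 * Real.pi) * (45 * (M + 1) * ε) ≤ G / (4 * Real.pi) * (45 * (M + 1) * ε) := by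
      gcongr; exact hγG j
    have e2 : G / (4 * Real.pi) * (45 * (M + 1) * ε) = G * (45 * (M + 1) / (4 * Real.pi)) * ε := by ring
    rw [e2] at e1
    refine e1.trans ?_
    gcongr
    linarith [show 0 ≤ 9 * C₀ * R / (4 * Real.pi * ρm ^ 3) by positivity]
  linarith [hsum, hA.le, hB, hx, hy]

/-- **Registered composing stub `stub_tameVerticalSubcritical`** (line `zero-accretion-selection`, STUB 5 — the endgame):
tame near-vertical length-regular equilibria are subcritical at their stagnation points. [folklore] -/
theorem stub_tameVerticalSubcritical :
    ∀ (N : ℕ) (γ : Fin N → ℝ) (α ρ K C₀ : ℝ), 0 < ρ → 0 < C₀ → ∃ C₂ : ℝ, 0 ≤ C₂ ∧ ∀ (R ρ' M : ℝ), 1 ≤ R → 0 < ρ' → ρ' ≤ 1 / 2 → 0 ≤ M → ∃ C₁ : ℝ, 0 ≤ C₁ ∧ ∀ (θ ε : ℝ), 0 < θ → θ ≤ 1 / 2 → 0 < ε → ε ≤ 1 → ∃ Γ₄ : ℝ, ∀ Γ : ℝ, Γ₄ ≤ Γ → 2 ≤ Γ → ∀ (Ξ : Fin N → ℝ → EuclideanSpace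 ℝ (Fin 3)) (w : Fin N → ℝ → ℝ), (∀ j, ContDiff ℝ 2 (Ξ j) ∧ Function.Injective (Ξ j) ∧ Differentiable ℝ (w j) ∧ (∀ τ, ‖deriv (Ξ j) τ‖ = 1) ∧ (∀ τ, ‖iteratedDeriv 2 (Ξ j) τ‖ * Real.sqrt Γ ≤ K) ∧ Tendsto (fun τ => ‖Ξ j τ‖) atTop atTop ∧ Tendsto (fun τ => ‖Ξ j τ‖) atBot atTop) → (∀ j k, j ≠ k → ∀ τ σ, ρ * Real.sqrt Γ ≤ ‖Ξ j τ - Ξ k σ‖) → (∀ j (x : EuclideanSpace ℝ (Fin 3)), Integrable (fun σ : ℝ => ((‖x - Ξ j σ‖ ^ 2 + 1) ^ (3 / 2 : ℝ))⁻¹ • cross (deriv (Ξ j) σ) (x - Ξ j σ))) → (∀ j τ, (∑ k : Fin N, (Γ * γ k / (4 * Real.pi)) • ∫ σ : ℝ, ((‖Ξ j τ - Ξ k σ‖ ^ 2 + 1) ^ (3 / 2 : ℝ))⁻¹ • cross (deriv (Ξ k) σ) (Ξ j τ - Ξ k σ)) + (1 / 2 : ℝ) • Ξ j τ - α • cross (EuclideanSpace.single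 (2 : Fin 3) (1 : ℝ)) (Ξ j τ) = w j τ • deriv (Ξ j) τ) → (∀ (k : Fin N) (x : EuclideanSpace ℝ (Fin 3)) (D : ℝ), Real.sqrt Γ ≤ D → volume {τ : ℝ | ‖Ξ k τ - x‖ ≤ D} ≤ ENNReal.ofReal (C₀ * D)) → ∀ (j : Fin N) (τs : ℝ), w j τs = 0 → (∀ (k : Fin N) (τ : ℝ), ‖Ξ k τ - Ξ j τs‖ ≤ R * Real.sqrt Γ → ‖cross (deriv (Ξ k) τ) (EuclideanSpace.single (2 : Fin 3) (1 : ℝ))‖ ≤ θ) → (∀ (k : Fin N) (τ τ' : ℝ), ‖Ξ k τ - Ξ j τs‖ ≤ R * Real.sqrt Γ → ‖Ξ k τ' - Ξ j τs‖ ≤ R * Real.sqrt Γ → ‖iteratedDeriv 2 (Ξ k) τ‖ * Real.sqrt (Γ * Real.log Γ / 2) ≤ M ∧ ‖iteratedDeriv 2 (Ξ k) τ - iteratedDeriv 2 (Ξ k) τ'‖ * Real.sqrt (Γ * Real.log Γ / 2) ≤ M * |τ - τ'| / Real.sqrt (Γ * Real.log Γ / 2) + ε) → (∀ (k : Fin N)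 (τ τ' : ℝ), ‖Ξ k τ - Ξ j τs‖ ≤ R * Real.sqrt Γ → ‖Ξ k τ' - Ξ j τs‖ ≤ R * Real.sqrt Γ → ‖Ξ k τ - Ξ k τ'‖ < ρ' * Real.sqrt Γ → |τ - τ'| ≤ 2 * ‖Ξ k τ - Ξ k τ'‖) → deriv (w j) τs ≤ 1 / 2 + C₁ * (θ + ε) + C₂ / R ^ 2 + 1 / 8 :=
  tameVertical_of_bounds stub_strainOtherFilament stub_strainSelfFilament

end Summit.NavierStokesRegularity.NavierStokesRegularity.Theorems.SkeletonEquilibrium.ZeroAccretionSelection
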